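import Summits.ResolutionOfSingularities.ResolutionOfSingularities.Theorems.WildPurityWildSymbolCoarseningCalculus
import HarnessLib

/-!
# `WildSymbol` (stmt-ResolutionOfSingularities-17133), line `birth` — dévissage of integrality along coarsenings

Support file (lead c2, crux cycle 3) for crux #2 of route `ResolutionOfSingularities/WildPurity`
(`Summit.ResolutionOfSingularities.ResolutionOfSingularities.Theses.WildPurity.WildSymbol`: a class `α` of Kato's
symbolic `H³_p(K) = G K ⧸ N p K` that is integral at every tested divisorial place but NOT `O`-integral,
`α ∉ Unr p K O`). Definitions: `Theorems/WildPurityWildSymbolBirthDefs.lean`; symbol identities below a coarsening: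
`Theorems/WildPurityWildSymbolCoarseningCalculus.lean`.

## The theorem (unconditional)

Let `O ≤ W` be valuation subrings of a field `K` (so `W` is a COARSENING of `O` and `𝔪_W ⊆ 𝔪_O ⊆ O`), let
`π : W → κ` be a surjective ring homomorphism onto a field with kernel `𝔪_W` (a residue map), and let
`Ō ⊆ κ` be the residual ring of `O` (`π x ∈ Ō ↔ x ∈ O`; it is a valuation ring of `κ`). Then

  `Unr p κ Ō = ⊤  ⟹  Unr p K W ≤ Unr p K O`   (`unr_le_unr_of_residual_absorption`),

hence `Unr p K O = Unr p K W` (`unr_eq_unr_of_residual_absorption`): **if the residual place absorbs the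
symbolic `H³_p` of the residue field, integrality at `O` is integrality at the coarsening `W`.**

Proof: the LIFT HOMOMORPHISM `L : G κ → (G K ⧸ N p K) ⧸ Unr p K O`, `[ā, b̄, c̄} ↦ [a, b, c}` for arbitrary lifts
(`exists_residualLift`), well defined by lift independence (`sym_sub_sym_mem_Unr_of_congr`); `L` kills the seven
relation shapes of `N p κ` (each lifts to the same shape in `K`; shape (vii) `[ā^p − ā, b̄, c̄}` lifts to
`[a^p − a, b, c}` — `residualLift_N_le_ker`) and the generators of `Unr p κ Ō` (they lift to `O`-integral symbols,
`O` being the full preimage of `Ō`); so absorption forces `L = 0`: every `W`-integral symbol is `O`-integral.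
In sheaf language this is the dévissage `H³_p(O) ← H³_p(W) → H³_p(κ) ⊇ Unr(Ō)` of integral classes along the
composite place `O = W ∘ Ō`; here it is proved inside the presentation, for arbitrary (non-noetherian) `O ≤ W`.

Also: `not_mem_Unr_coarsening_of_residual_absorption` (non-integrality ASCENDS to such a coarsening) and the
instance for the canonical residue field `unr_le_unr_of_residueField_absorption` (`IsLocalRing.residue`, `Ō` the
image of `O`). Consequences for the crux (negative lemmas, witnesses ascend):
`Theorems/WildPurityWildSymbolResidualAbsorptionCalibration.lean`. No definition is declared; nothing concludes
the crux.
-/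

noncomputable section

-- single-problem summit: the doubled namespace component `ResolutionOfSingularities` is forced
set_option linter.dupNamespace false

namespace Summit.ResolutionOfSingularities.ResolutionOfSingularities.Theorems.WildSymbol.Birth

section Lift

variable {p : ℕ} {K : Type} [Field K]

/-! ## The lift homomorphism `G κ → (G K ⧸ N p K) ⧸ Unr O` -/

/-- **The lift homomorphism exists.** For `O ≤ W`, a surjective ring homomorphism `π : W → κ` onto a field with
kernel `𝔪_W`, there is an additive map `L : G κ → (G K ⧸ N p K) ⧸ Unr p K O` with
`L [ra, rb, rc} = [a, b, c} mod Unr O` for EVERY choice of lifts `a ∈ W`, `b, c ∈ Wˣ` (lift independence).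
[folklore] -/
theorem exists_residualLift {O W : ValuationSubring K} (hOW : O ≤ W) {κ : Type} [Field κ] (π : W →+* κ)
    (hπ : Function.Surjective π) (hker : ∀ x : W, π x = 0 ↔ (x : K) ∈ W.nonunits) :
    ∃ L : G κ →+ (G K ⧸ N p K) ⧸ Unr p K O.toSubring,
      ∀ (ra : κ) (rb rc : κˣ) (a b c : W) (hb0 : (b : K) ≠ 0) (hc0 : (c : K) ≠ 0),
        π a = ra → π b = rb → π c = rc →
        L (FreeAbelianGroup.of (ra, rb, rc)) =
          QuotientAddGroup.mk' (Unr p K O.toSubring) (((FreeAbelianGroup.of ((((a : K) : K), (Units.mk0 (b : K) hb0 : Kˣ), (Units.mk0 (c : K) hc0 : Kˣ)) : K × Kˣ × Kˣ) : G K)) : G K ⧸ N p K) := by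
  classical
  choose s hs using hπ
  -- a lift of a non-zero residue is a unit of `W`
  have hunit : ∀ x : W, π x ≠ 0 → (x : K) ∉ W.nonunits := fun x hx h => hx ((hker x).mpr h)
  have hne : ∀ x : W, π x ≠ 0 → (x : K) ≠ 0 := fun x hx h =>
    hx (by rw [show x = 0 from Subtype.ext h, map_zero])
  have hinv : ∀ x : W, π x ≠ 0 → (x : K)⁻¹ ∈ W := fun x hx => inv_mem_of_not_mem_nonunits W (hunit x hx)
  have hsub : ∀ x y : W, π x = π y → (x : K) - y ∈ W.nonunits := fun x y h => by
    have : ((x - y : W) : K) ∈ W.nonunits := (hker _).mp (by rw [map_sub, h, sub_self])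
    simpa using this
  have hs0 : ∀ rb : κˣ, ((s (rb : κ) : W) : K) ≠ 0 := fun rb =>
    hne _ (by rw [hs]; exact rb.ne_zero)
  refine ⟨FreeAbelianGroup.lift fun τ => QuotientAddGroup.mk' (Unr p K O.toSubring)
      (((FreeAbelianGroup.of (((((s τ.1 : W) : K) : K), (Units.mk0 ((s (τ.2.1 : κ) : W) : K) (hs0 τ.2.1) : Kˣ), (Units.mk0 ((s (τ.2.2 : κ) : W) : K) (hs0 τ.2.2) : Kˣ)) : K × Kˣ × Kˣ) : G K)) : G K ⧸ N p K), ?_⟩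
  intro ra rb rc a b c hb0 hc0 hra hrb hrc
  rw [FreeAbelianGroup.lift_apply_of, QuotientAddGroup.mk'_apply, QuotientAddGroup.mk'_apply,
    QuotientAddGroup.eq_iff_sub_mem]
  have hπb : π b ≠ 0 := by rw [hrb]; exact rb.ne_zero
  have hπc : π c ≠ 0 := by rw [hrc]; exact rc.ne_zero
  have hπsb : π (s (rb : κ)) ≠ 0 := by rw [hs]; exact rb.ne_zero
  have hπsc : π (s (rc : κ)) ≠ 0 := by rw [hs]; exact rc.ne_zero
  refine sym_sub_sym_mem_Unr_of_congr hOW a.2 (hsub _ _ (by rw [hs, hra])) (s (rb : κ)).2 ?_ b.2 ?_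
    (hsub _ _ (by rw [hs, hrb])) (s (rc : κ)).2 ?_ ?_ (hsub _ _ (by rw [hs, hrc]))
  · rw [Units.val_inv_eq_inv_val]; exact hinv _ hπsb
  · rw [Units.val_inv_eq_inv_val]; exact hinv _ hπb
  · rw [Units.val_inv_eq_inv_val]; exact hinv _ hπsc
  · rw [Units.val_inv_eq_inv_val]; exact hinv _ hπc

/-- **The lift homomorphism kills Kato's relations of the residue field**: each of the seven relation shapes of
`N p κ` lifts to the same shape in `K` (the residue map is a ring homomorphism; shape (vii) `[ra^p − ra, rb, rc}`
lifts to `[a^p − a, b, c}`). [folklore] -/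
theorem residualLift_N_le_ker {O W : ValuationSubring K} {κ : Type} [Field κ] (π : W →+* κ)
    (hπ : Function.Surjective π) (L : G κ →+ (G K ⧸ N p K) ⧸ Unr p K O.toSubring)
    (hL : ∀ (ra : κ) (rb rc : κˣ) (a b c : W) (hb0 : (b : K) ≠ 0) (hc0 : (c : K) ≠ 0),
        π a = ra → π b = rb → π c = rc →
        L (FreeAbelianGroup.of (ra, rb, rc)) =
          QuotientAddGroup.mk' (Unr p K O.toSubring) (((FreeAbelianGroup.of ((((a : K) : K), (Units.mk0 (b : K) hb0 : Kˣ), (Units.mk0 (c : K) hc0 : Kˣ)) : K × Kˣ × Kˣ) : G K)) : G K ⧸ N p K)) :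
    N p κ ≤ L.ker := by
  have hne : ∀ x : W, π x ≠ 0 → (x : K) ≠ 0 := fun x hx h =>
    hx (by rw [show x = 0 from Subtype.ext h, map_zero])
  -- lifts of units of `κ`, as units of `K`
  have hlift : ∀ rb : κˣ, ∃ (b : W) (hb0 : (b : K) ≠ 0), π b = rb := fun rb => by
    obtain ⟨b, hb⟩ := hπ rb
    exact ⟨b, hne b (by rw [hb]; exact rb.ne_zero), hb⟩
  have hmul : ∀ (b b' : W) (hb0 : (b : K) ≠ 0) (hb'0 : (b' : K) ≠ 0),
      Units.mk0 ((b * b' : W) : K) (by push_cast; exact mul_ne_zero hb0 hb'0) =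
        Units.mk0 (b : K) hb0 * Units.mk0 (b' : K) hb'0 := fun b b' hb0 hb'0 => Units.ext (by simp)
  refine (AddSubgroup.closure_le _).mpr ?_
  rintro x (⟨ra, ra', rb, rc, rfl⟩ | ⟨ra, rb, rb', rc, rfl⟩ | ⟨ra, rb, rc, rc', rfl⟩ | ⟨ra, rb, rfl⟩ |
    ⟨rb, rc, rfl⟩ | ⟨rb, rc, rfl⟩ | ⟨ra, rb, rc, rfl⟩) <;>
    simp only [SetLike.mem_coe, AddMonoidHom.mem_ker, map_sub]
  · -- (i) additivity in the first slot
    obtain ⟨a, ha⟩ := hπ ra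
    obtain ⟨a', ha'⟩ := hπ ra'
    obtain ⟨b, hb0, hb⟩ := hlift rb
    obtain ⟨c, hc0, hc⟩ := hlift rc
    rw [hL _ _ _ (a + a') b c hb0 hc0 (by rw [map_add, ha, ha']) hb hc, hL _ _ _ a b c hb0 hc0 ha hb hc,
      hL _ _ _ a' b c hb0 hc0 ha' hb hc, ← map_sub, ← map_sub, Subring.coe_add, sym_add_left]
    simp
  · -- (ii) multiplicativity in the middle slot
    obtain ⟨a, ha⟩ := hπ ra
    obtain ⟨b, hb0, hb⟩ := hlift rb
    obtain ⟨b', hb'0, hb'⟩ := hlift rb'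
    obtain ⟨c, hc0, hc⟩ := hlift rc
    rw [hL _ _ _ a (b * b') c (by push_cast; exact mul_ne_zero hb0 hb'0) hc0 ha
        (by rw [map_mul, hb, hb', Units.val_mul]) hc,
      hL _ _ _ a b c hb0 hc0 ha hb hc, hL _ _ _ a b' c hb'0 hc0 ha hb' hc, ← map_sub, ← map_sub,
      hmul b b' hb0 hb'0, sym_mul_mid]
    simp
  · -- (iii) multiplicativity in the last slot
    obtain ⟨a, ha⟩ := hπ ra
    obtain ⟨b, hb0, hb⟩ := hlift rb
    obtain ⟨c, hc0, hc⟩ := hlift rc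
    obtain ⟨c', hc'0, hc'⟩ := hlift rc'
    rw [hL _ _ _ a b (c * c') hb0 (by push_cast; exact mul_ne_zero hc0 hc'0) ha hb
        (by rw [map_mul, hc, hc', Units.val_mul]),
      hL _ _ _ a b c hb0 hc0 ha hb hc, hL _ _ _ a b c' hb0 hc'0 ha hb hc', ← map_sub, ← map_sub,
      hmul c c' hc0 hc'0, sym_mul_right]
    simp
  · -- (iv) alternation
    obtain ⟨a, ha⟩ := hπ ra
    obtain ⟨b, hb0, hb⟩ := hlift rb
    rw [hL _ _ _ a b b hb0 hb0 ha hb hb, sym_diag, map_zero]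
  · -- (v) `[rb, rb, rc}`
    obtain ⟨b, hb0, hb⟩ := hlift rb
    obtain ⟨c, hc0, hc⟩ := hlift rc
    rw [hL _ _ _ b b c hb0 hc0 hb hb hc]
    have h5 : (((FreeAbelianGroup.of (((((b : W) : K) : K), (Units.mk0 ((b : W) : K) hb0 : Kˣ), (Units.mk0 ((c : W) : K) hc0 : Kˣ)) : K × Kˣ × Kˣ) : G K)) : G K ⧸ N p K) = 0 :=
      sym_self_mid (p := p) (Units.mk0 _ hb0) (Units.mk0 _ hc0)
    rw [h5, map_zero]
  · -- (vi) `[rc, rb, rc}`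
    obtain ⟨b, hb0, hb⟩ := hlift rb
    obtain ⟨c, hc0, hc⟩ := hlift rc
    rw [hL _ _ _ c b c hb0 hc0 hc hb hc]
    have h6 : (((FreeAbelianGroup.of (((((c : W) : K) : K), (Units.mk0 ((b : W) : K) hb0 : Kˣ), (Units.mk0 ((c : W) : K) hc0 : Kˣ)) : K × Kˣ × Kˣ) : G K)) : G K ⧸ N p K) = 0 := by
      rw [sym_antisymm]
      exact neg_eq_zero.mpr (sym_self_mid (p := p) (Units.mk0 _ hc0) (Units.mk0 _ hb0))
    rw [h6, map_zero]
  · -- (vii) Artin–Schreier `[ra^p − ra, rb, rc}`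
    obtain ⟨a, ha⟩ := hπ ra
    obtain ⟨b, hb0, hb⟩ := hlift rb
    obtain ⟨c, hc0, hc⟩ := hlift rc
    rw [hL _ _ _ (a ^ p - a) b c hb0 hc0 (by rw [map_sub, map_pow, ha]) hb hc]
    push_cast
    rw [sym_sub_left, sym_frobenius, sub_self, map_zero]

/-! ## The dévissage theorem -/

/-- **Dévissage of integrality along a coarsening.** Let `O ≤ W` be valuation subrings of `K`, `π : W → κ` a
surjective ring homomorphism onto a field with kernel `𝔪_W`, and `Ō ⊆ κ` the residual ring of `O`
(`π x ∈ Ō ↔ x ∈ O`). If the residual place absorbs the symbolic `H³_p(κ)` — `Unr p κ Ō = ⊤` — then every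
`W`-integral class is `O`-integral: `Unr p K W ≤ Unr p K O`. [folklore] -/
theorem unr_le_unr_of_residual_absorption {O W : ValuationSubring K} (hOW : O ≤ W) {κ : Type} [Field κ] (π : W →+* κ) (hπ : Function.Surjective π) (hker : ∀ x : W, π x = 0 ↔ (x : K) ∈ W.nonunits) (Ō : Subring κ) (hŌ : ∀ x : W, π x ∈ Ō ↔ (x : K) ∈ O) (habs : Unr p κ Ō = ⊤) : Unr p K W.toSubring ≤ Unr p K O.toSubring := by
  obtain ⟨L, hL⟩ := exists_residualLift (p := p) hOW π hπ hker
  have hne : ∀ x : W, π x ≠ 0 → (x : K) ≠ 0 := fun x hx h =>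
    hx (by rw [show x = 0 from Subtype.ext h, map_zero])
  have hunit : ∀ x : W, π x ≠ 0 → (x : K) ∉ W.nonunits := fun x hx h => hx ((hker x).mpr h)
  -- the descended homomorphism `L̄ : G κ ⧸ N p κ → (G K ⧸ N p K) ⧸ Unr O`
  let Lbar := QuotientAddGroup.lift (N p κ) L (residualLift_N_le_ker π hπ L hL)
  -- `L̄` kills the residual integral symbols: they lift to `O`-integral symbols
  have hUnr : Unr p κ Ō ≤ Lbar.ker := by
    refine (AddSubgroup.closure_le _).mpr ?_
    rintro _ ⟨ra, rb, rc, hra, hrb, hrbi, hrc, hrci, rfl⟩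
    obtain ⟨a, ha⟩ := hπ ra
    obtain ⟨b, hb⟩ := hπ rb
    obtain ⟨c, hc⟩ := hπ rc
    have hπb : π b ≠ 0 := by rw [hb]; exact rb.ne_zero
    have hπc : π c ≠ 0 := by rw [hc]; exact rc.ne_zero
    have hb0 : (b : K) ≠ 0 := hne b hπb
    have hc0 : (c : K) ≠ 0 := hne c hπc
    -- inverses of the lifts lie in `O` as well (`O` is the full preimage of `Ō`)
    have hinvO : ∀ (x : W) (rx : κˣ), π x = rx → ((rx⁻¹ : κˣ) : κ) ∈ Ō → (x : K)⁻¹ ∈ O := by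
      intro x rx hx hrxi
      have hπx : π x ≠ 0 := by rw [hx]; exact rx.ne_zero
      have hxinv : (x : K)⁻¹ ∈ W := inv_mem_of_not_mem_nonunits W (hunit x hπx)
      refine (hŌ ⟨(x : K)⁻¹, hxinv⟩).mp ?_
      have hprod : (⟨(x : K)⁻¹, hxinv⟩ : W) * x = 1 := Subtype.ext (inv_mul_cancel₀ (hne x hπx))
      have : π ⟨(x : K)⁻¹, hxinv⟩ = (π x)⁻¹ :=
        eq_inv_of_mul_eq_one_left (by rw [← map_mul, hprod, map_one])
      rw [this, hx, ← Units.val_inv_eq_inv_val]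
      exact hrxi
    simp only [SetLike.mem_coe, AddMonoidHom.mem_ker, Lbar, QuotientAddGroup.lift_mk,
      hL ra rb rc a b c hb0 hc0 ha hb hc, QuotientAddGroup.mk'_apply, QuotientAddGroup.eq_zero_iff]
    refine sym_mem_Unr ((hŌ a).mp (by rw [ha]; exact hra)) ((hŌ b).mp (by rw [hb]; exact hrb)) ?_
      ((hŌ c).mp (by rw [hc]; exact hrc)) ?_
    · rw [Units.val_inv_eq_inv_val]; exact hinvO b rb hb hrbi
    · rw [Units.val_inv_eq_inv_val]; exact hinvO c rc hc hrci
  have hzero : ∀ z : G κ ⧸ N p κ, Lbar z = 0 := fun z =>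
    (AddMonoidHom.mem_ker).mp (hUnr (by rw [habs]; trivial))
  -- every `W`-integral symbol is `O`-integral
  refine (AddSubgroup.closure_le _).mpr ?_
  rintro _ ⟨a, b, c, ha, hb, hbi, hc, hci, rfl⟩
  have hbu : (b : K) ∉ W.nonunits := fun h => by
    have := mul_mem_nonunits W h hbi
    rw [Units.val_inv_eq_inv_val, mul_inv_cancel₀ b.ne_zero] at this
    exact (one_add_not_mem_nonunits W W.nonunits.zero_mem) (by simpa using this)
  have hcu : (c : K) ∉ W.nonunits := fun h => by
    have := mul_mem_nonunits W h hci
    rw [Units.val_inv_eq_inv_val, mul_inv_cancel₀ c.ne_zero] at this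
    exact (one_add_not_mem_nonunits W W.nonunits.zero_mem) (by simpa using this)
  have hπb : π ⟨b, hb⟩ ≠ 0 := fun h => hbu ((hker _).mp h)
  have hπc : π ⟨c, hc⟩ ≠ 0 := fun h => hcu ((hker _).mp h)
  have key := hL (π ⟨a, ha⟩) (Units.mk0 _ hπb) (Units.mk0 _ hπc) ⟨a, ha⟩ ⟨b, hb⟩ ⟨c, hc⟩ b.ne_zero c.ne_zero
    rfl rfl rfl
  simp only [Units.mk0_val] at key
  have h0 : L (FreeAbelianGroup.of (π ⟨a, ha⟩, Units.mk0 _ hπb, Units.mk0 _ hπc)) = 0 := by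
    rw [← QuotientAddGroup.lift_mk (N p κ) (residualLift_N_le_ker π hπ L hL)]
    exact hzero _
  rw [key, QuotientAddGroup.mk'_apply, QuotientAddGroup.eq_zero_iff] at h0
  exact h0

/-- `Unr` is monotone in the ring (membership form). [folklore] -/
theorem unr_le_unr_of_le {O W : ValuationSubring K} (hOW : O ≤ W) :
    Unr p K O.toSubring ≤ Unr p K W.toSubring :=
  AddSubgroup.closure_mono fun _ ⟨a, b, c, ha, hb, hb', hc, hc', hy⟩ =>
    ⟨a, b, c, hOW ha, hOW hb, hOW hb', hOW hc, hOW hc', hy⟩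

/-- **`Unr O = Unr W` under residual absorption** (`O ≤ W`; hypotheses as in
`unr_le_unr_of_residual_absorption`). [folklore] -/
theorem unr_eq_unr_of_residual_absorption {O W : ValuationSubring K} (hOW : O ≤ W) {κ : Type} [Field κ]
    (π : W →+* κ) (hπ : Function.Surjective π) (hker : ∀ x : W, π x = 0 ↔ (x : K) ∈ W.nonunits)
    (Ō : Subring κ) (hŌ : ∀ x : W, π x ∈ Ō ↔ (x : K) ∈ O) (habs : Unr p κ Ō = ⊤) :
    Unr p K O.toSubring = Unr p K W.toSubring :=
  le_antisymm (unr_le_unr_of_le hOW) (unr_le_unr_of_residual_absorption hOW π hπ hker Ō hŌ habs)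

/-- **Non-integrality ascends to a coarsening with absorbing residual place.** [folklore] -/
theorem not_mem_Unr_coarsening_of_residual_absorption {O W : ValuationSubring K} (hOW : O ≤ W) {κ : Type}
    [Field κ] (π : W →+* κ) (hπ : Function.Surjective π) (hker : ∀ x : W, π x = 0 ↔ (x : K) ∈ W.nonunits)
    (Ō : Subring κ) (hŌ : ∀ x : W, π x ∈ Ō ↔ (x : K) ∈ O) (habs : Unr p κ Ō = ⊤) {α : G K ⧸ N p K}
    (hα : α ∉ Unr p K O.toSubring) : α ∉ Unr p K W.toSubring :=
  fun h => hα (unr_le_unr_of_residual_absorption hOW π hπ hker Ō hŌ habs h)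

/-! ## The canonical residue field -/

/-- The dévissage for the canonical residue map `W → W/𝔪_W` (`IsLocalRing.residue`), with the residual ring of
`O` realised as the image of `O ∩ W = O`. [folklore] -/
theorem unr_le_unr_of_residueField_absorption {O W : ValuationSubring K} (hOW : O ≤ W)
    (habs : Unr p (IsLocalRing.ResidueField W)
      ((O.toSubring.comap W.toSubring.subtype).map (IsLocalRing.residue W)) = ⊤) :
    Unr p K W.toSubring ≤ Unr p K O.toSubring := by
  refine unr_le_unr_of_residual_absorption hOW (IsLocalRing.residue W) IsLocalRing.residue_surjective
    (fun x => ?_) _ (fun x => ⟨?_, fun hx => Subring.mem_map.mpr ⟨x, hx, rfl⟩⟩) habs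
  · rw [IsLocalRing.residue_eq_zero_iff, ← ValuationSubring.coe_mem_nonunits_iff]
  · rintro ⟨y, hy, hxy⟩
    have h : x - y ∈ IsLocalRing.maximalIdeal W := by
      rw [← IsLocalRing.residue_eq_zero_iff, map_sub, hxy, sub_self]
    have h' : ((x - y : W) : K) ∈ O :=
      nonunits_subset_of_le hOW (ValuationSubring.coe_mem_nonunits_iff.mpr h)
    have : (x : K) = ((x - y : W) : K) + (y : K) := by push_cast; ring
    show (x : K) ∈ O.toSubring
    rw [this]
    exact O.add_mem _ _ h' hy

end Lift

end Summit.ResolutionOfSingularities.ResolutionOfSingularities.Theorems.WildSymbol.Birth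

end
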